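import Literature.Analysis.FluidPDE.PassiveVectorTensorDistorted
import Literature.Analysis.FunctionSpaces.TorusAnalyticSeminorm
import Literature.Analysis.FunctionSpaces.TorusTestFunction
import HarnessLib

/-!
# Frame-corrected test fields `Ψ = J • φ`: the regularity clauses of the distorted weak class
# (the `ad-ideate` brick FT between the frame-regularity package FR and the pairing identity (ID))

Analysis/FluidPDE proof file (theorems only; no definitions, no named facts). For a matrix field
`J : ℝ × T^d → Matrix d d ℝ` (entries `(t, y) ↦ J t y a c`) and a vector field `φ : ℝ × T^d → ℝ^d`, the
DISTORTED field `Ψ t := Torus.distort (J t) (φ t)` (`Ψ(t,y) = J(t,y) φ(t,y)`) inherits the three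
test clauses of the distorted weak class `Torus.IsWeakTensorPassiveVectorDistortedOn`
(`PassiveVectorTensorDistortedDuality` §2 / `…FramePairing.ae_integral_inner_distort_frame_eq`):
* FT1 `isSmooth_distort` — smooth slices;
* FT2 `continuous_uncurry_iterPartialDeriv_distort` — ALL iterated space derivatives jointly
  continuous on `ℝ × T^d`, from the same for the entries of `J` and for `φ` (Leibniz rule by
  induction on the word, peeled from the inside via `iterPartialDeriv_append`; no bounds needed);
* FT3 `exists_lipschitz_distort` — Lipschitz in time on `[0,T]` uniformly in space, from entrywise
  Lipschitz + bounds; `norm_distort_le_of_le` — the sup bound;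
* bridges: `distort_apply_eq_sum` (`(J•φ)_a = Σ_c J_{ac} φ_c`), `iterPartialDeriv_distort_apply`
  (components of `∂^l(J•φ)`), and the CLAMP corollaries `continuous_uncurry_clamp_of_continuousOn_stLift`,
  `continuous_uncurry_iterPartialDeriv_clamp` turning window statements (`ContinuousOn (stLift ψ) (Icc a b ×ˢ univ)`,
  the currency of `TorusFlowFrameRegularity`) into the global-in-time continuity of the clamped field
  `t ↦ ψ (max a (min t b))`.

## References

* R. J. DiPerna, P.-L. Lions, *Ordinary differential equations, transport theory and Sobolev spaces*,
  Invent. Math. 98 (1989), §II.1 (test functions for the transport equation). [`DiPernaLions1989Invent`]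
* L. C. Evans, *Partial Differential Equations*, 2nd ed., AMS 2010, App. C (Leibniz formula). [`Evans2010`]
-/

noncomputable section

open Set Filter Topology Function
open scoped ContDiff

namespace Literature.Analysis.FluidPDE

namespace Torus

open Literature.Analysis.FunctionSpaces Literature.Analysis.FunctionSpaces.Torus

variable {d : Type*} [Fintype d] [DecidableEq d]

/-! ## §1 Products and sums of scalar space–time fields with jointly continuous space derivatives -/

/-- **Leibniz closure**: if `f, g : ℝ × T^d → ℝ` have smooth slices and ALL iterated space derivatives
jointly continuous on `ℝ × T^d`, so does the product `f g`. (Induction on the word, innermost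
derivative first: `∂^{l++[i]}(fg) = ∂^l((∂ᵢf) g + f ∂ᵢg)`.) [cite: Evans2010, App. C (Leibniz formula)] -/
theorem continuous_uncurry_iterPartialDeriv_mul {f g : ℝ → UnitAddTorus d → ℝ}
    (hfs : ∀ t, IsSmooth (f t)) (hgs : ∀ t, IsSmooth (g t))
    (hfc : ∀ l : List d, Continuous (uncurry fun t y => iterPartialDeriv l (f t) y))
    (hgc : ∀ l : List d, Continuous (uncurry fun t y => iterPartialDeriv l (g t) y)) (l : List d) :
    Continuous (uncurry fun t y => iterPartialDeriv l (fun y => f t y * g t y) y) := by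
  induction l using List.reverseRecOn generalizing f g with
  | nil =>
    exact (hfc []).mul (hgc [])
  | append_singleton l i ih =>
    have hf1 : ∀ t, IsContDiff 1 (f t) := fun t => (hfs t).isContDiff (by simp)
    have hg1 : ∀ t, IsContDiff 1 (g t) := fun t => (hgs t).isContDiff (by simp)
    -- `∂^{l++[i]}(fg) = ∂^l (f ∂ᵢg) + ∂^l ((∂ᵢf) g)`
    have e : ∀ t, iterPartialDeriv (l ++ [i]) (fun y => f t y * g t y) = fun y =>
        iterPartialDeriv l (fun y => f t y * FunctionSpaces.Torus.partialDeriv i (g t) y) y +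
          iterPartialDeriv l (fun y => FunctionSpaces.Torus.partialDeriv i (f t) y * g t y) y := by
      intro t
      rw [iterPartialDeriv_append]
      have e1 : iterPartialDeriv [i] (fun y => f t y * g t y) =
          fun y => f t y * FunctionSpaces.Torus.partialDeriv i (g t) y + FunctionSpaces.Torus.partialDeriv i (f t) y * g t y := by
        funext y
        simp only [iterPartialDeriv_cons, iterPartialDeriv_nil]
        exact FunctionSpaces.Torus.partialDeriv_mul (hf1 t) (hg1 t) i y
      rw [e1]
      exact iterPartialDeriv_add ((hfs t).smul' ((hgs t).partialDeriv i)) (((hfs t).partialDeriv i).smul' (hgs t)) l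
    have h1 := ih (f := f) (g := fun t => FunctionSpaces.Torus.partialDeriv i (g t)) hfs (fun t => (hgs t).partialDeriv i) hfc
      (fun l' => by simpa [iterPartialDeriv_append] using hgc (l' ++ [i]))
    have h2 := ih (f := fun t => FunctionSpaces.Torus.partialDeriv i (f t)) (g := g) (fun t => (hfs t).partialDeriv i) hgs
      (fun l' => by simpa [iterPartialDeriv_append] using hfc (l' ++ [i])) hgc
    have e' : (uncurry fun t y => iterPartialDeriv (l ++ [i]) (fun y => f t y * g t y) y) =
        fun p => (uncurry fun t y => iterPartialDeriv l (fun y => f t y * FunctionSpaces.Torus.partialDeriv i (g t) y) y) p +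
          (uncurry fun t y => iterPartialDeriv l (fun y => FunctionSpaces.Torus.partialDeriv i (f t) y * g t y) y) p := by
      funext ⟨t, y⟩
      simp only [uncurry_apply_pair, e t]
    rw [e']
    exact h1.add h2

/-- Finite sums of fields with smooth slices and jointly continuous space derivatives keep both
properties (the continuity clause). [cite: Evans2010, App. C.1–C.2 (calculus of smooth functions: linearity of ∂^α)] -/
theorem continuous_uncurry_iterPartialDeriv_finset_sum {ι : Type*} (s : Finset ι) {f : ι → ℝ → UnitAddTorus d → ℝ}
    (hfs : ∀ i ∈ s, ∀ t, IsSmooth (f i t))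
    (hfc : ∀ i ∈ s, ∀ l : List d, Continuous (uncurry fun t y => iterPartialDeriv l (f i t) y)) (l : List d) :
    Continuous (uncurry fun t y => iterPartialDeriv l (fun y => ∑ i ∈ s, f i t y) y) := by
  have e : (uncurry fun t y => iterPartialDeriv l (fun y => ∑ i ∈ s, f i t y) y) =
      fun p => ∑ i ∈ s, (uncurry fun t y => iterPartialDeriv l (f i t) y) p := by
    funext ⟨t, y⟩
    simp only [uncurry_apply_pair]
    rw [iterPartialDeriv_finset_sum s (fun i hi => hfs i hi t) l]
  rw [e]
  exact continuous_finsetSum s fun i hi => hfc i hi l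

/-! ## §2 The distorted field `Ψ = J • φ` -/

variable {J : ℝ → UnitAddTorus d → Matrix d d ℝ} {φ : ℝ → UnitAddTorus d → EuclideanSpace ℝ d}

omit [DecidableEq d] in
/-- Components of the distorted field: `(J • φ)(y)_a = Σ_c J(y)_{ac} φ(y)_c`. [cite: DiPernaLions1989Invent, §II.1 (vector test fields, componentwise)] -/
theorem distort_apply_eq_sum (G : UnitAddTorus d → Matrix d d ℝ) (v : UnitAddTorus d → EuclideanSpace ℝ d)
    (y : UnitAddTorus d) (a : d) : distort G v y a = ∑ c, G y a c * v y c := by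
  rw [distort_apply]

omit [DecidableEq d] in
/-- **FT1**: `J • φ` has smooth slices if the entries of `J` and `φ` do. [cite: Evans2010, App. C.2 (products of smooth functions are smooth)] -/
theorem isSmooth_distort {G : UnitAddTorus d → Matrix d d ℝ} {v : UnitAddTorus d → EuclideanSpace ℝ d}
    (hG : ∀ a c, IsSmooth (fun y => G y a c)) (hv : IsSmooth v) : IsSmooth (distort G v) := by
  have hcomp : ∀ a, ContDiff ℝ ∞ (fun z => lift (distort G v) z a) := by
    intro a
    have e : (fun z => lift (distort G v) z a) =
        fun z => ∑ c, lift (fun y => G y a c) z * lift (fun y => v y c) z := by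
      funext z
      simp only [lift_apply, distort_apply_eq_sum]
    rw [e]
    exact ContDiff.sum fun c _ =>
      (show ContDiff ℝ ∞ (lift fun y => G y a c) from hG a c).mul
        (show ContDiff ℝ ∞ (lift fun y => v y c) from hv.apply c)
  show ContDiff ℝ ∞ (lift (distort G v))
  exact contDiff_piLp' (p := 2) hcomp

/-- **Bridge**: the components of the iterated space derivatives of `J • φ` are the iterated space
derivatives of the scalar fields `Σ_c J_{ac} φ_c`. [cite: Evans2010, App. C.1 (multiindex derivatives, componentwise)] -/
theorem iterPartialDeriv_distort_apply {G : UnitAddTorus d → Matrix d d ℝ} {v : UnitAddTorus d → EuclideanSpace ℝ d}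
    (hG : ∀ a c, IsSmooth (fun y => G y a c)) (hv : IsSmooth v) (l : List d) (y : UnitAddTorus d) (a : d) :
    iterPartialDeriv l (distort G v) y a = iterPartialDeriv l (fun y => ∑ c, G y a c * v y c) y := by
  rw [← show (fun y => distort G v y a) = fun y => ∑ c, G y a c * v y c from
    funext fun y => distort_apply_eq_sum G v y a]
  exact (congrFun (iterPartialDeriv_apply_coord (isSmooth_distort hG hv) a l) y).symm

/-- **FT2**: if every entry of `J` and the field `φ` have smooth slices and ALL iterated space
derivatives jointly continuous on `ℝ × T^d`, then so does `J • φ`. [cite: Evans2010, App. C (Leibniz formula)] -/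
theorem continuous_uncurry_iterPartialDeriv_distort (hJs : ∀ t a c, IsSmooth (fun y => J t y a c))
    (hφs : ∀ t, IsSmooth (φ t))
    (hJc : ∀ (l : List d) (a c : d), Continuous (uncurry fun t y => iterPartialDeriv l (fun y => J t y a c) y))
    (hφc : ∀ l : List d, Continuous (uncurry fun t y => iterPartialDeriv l (φ t) y)) (l : List d) :
    Continuous (uncurry fun t y => iterPartialDeriv l (distort (J t) (φ t)) y) := by
  -- componentwise
  have hcomp : ∀ a, Continuous (uncurry fun t y => iterPartialDeriv l (distort (J t) (φ t)) y a) := by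
    intro a
    have e : (uncurry fun t y => iterPartialDeriv l (distort (J t) (φ t)) y a) =
        uncurry fun t y => iterPartialDeriv l (fun y => ∑ c, J t y a c * φ t y c) y := by
      funext ⟨t, y⟩
      exact iterPartialDeriv_distort_apply (hJs t) (hφs t) l y a
    rw [e]
    refine continuous_uncurry_iterPartialDeriv_finset_sum _ (fun c _ t => (hJs t a c).smul' ((hφs t).apply c))
      (fun c _ l' => ?_) l
    refine continuous_uncurry_iterPartialDeriv_mul (fun t => hJs t a c) (fun t => (hφs t).apply c) (fun l'' => hJc l'' a c)
      (fun l'' => ?_) l'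
    have e2 : (uncurry fun t y => iterPartialDeriv l'' (fun y => φ t y c) y) =
        fun p => (uncurry fun t y => iterPartialDeriv l'' (φ t) y) p c := by
      funext ⟨t, y⟩
      exact congrFun (iterPartialDeriv_apply_coord (hφs t) c l'') y
    rw [e2]
    exact (EuclideanSpace.proj c).continuous.comp (hφc l'')
  have e : (uncurry fun t y => iterPartialDeriv l (distort (J t) (φ t)) y) =
      fun p => WithLp.toLp 2 (fun a => (uncurry fun t y => iterPartialDeriv l (distort (J t) (φ t)) y a) p) := by
    funext ⟨t, y⟩
    rfl
  rw [e]
  exact (PiLp.continuous_toLp 2 _).comp (continuous_pi hcomp)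

omit [DecidableEq d] in
/-- From componentwise bounds to the Euclidean norm: `|w_a| ≤ M` for all `a` gives `‖w‖ ≤ √d · M`. [folklore] -/
private theorem norm_le_sqrt_card_mul {w : EuclideanSpace ℝ d} {M : ℝ} (hM : 0 ≤ M) (h : ∀ a, |w a| ≤ M) :
    ‖w‖ ≤ Real.sqrt (Fintype.card d) * M := by
  rw [EuclideanSpace.norm_eq]
  have hs : ∑ a, ‖w a‖ ^ 2 ≤ ∑ _a : d, M ^ 2 := Finset.sum_le_sum fun a _ => by
    rw [Real.norm_eq_abs]
    exact pow_le_pow_left₀ (abs_nonneg _) (h a) 2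
  rw [Finset.sum_const, Finset.card_univ, nsmul_eq_mul] at hs
  calc Real.sqrt (∑ a, ‖w a‖ ^ 2) ≤ Real.sqrt ((Fintype.card d : ℝ) * M ^ 2) := Real.sqrt_le_sqrt hs
    _ = Real.sqrt (Fintype.card d) * M := by rw [Real.sqrt_mul (Nat.cast_nonneg _), Real.sqrt_sq hM]

omit [DecidableEq d] in
/-- **Sup bound**: `‖(J • φ)(y)‖ ≤ √d · d · B · ‖φ(y)‖` when `|J(y)_{ac}| ≤ B`. [cite: DiPernaLions1989Invent, §II.1 (bounded test fields)] -/
theorem norm_distort_le_of_le {G : UnitAddTorus d → Matrix d d ℝ} {B : ℝ} (hB0 : 0 ≤ B)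
    (v : UnitAddTorus d → EuclideanSpace ℝ d) (y : UnitAddTorus d) (hB : ∀ a c, |G y a c| ≤ B) :
    ‖distort G v y‖ ≤ Real.sqrt (Fintype.card d) * ((Fintype.card d : ℝ) * B * ‖v y‖) := by
  refine norm_le_sqrt_card_mul (by positivity) fun a => ?_
  rw [distort_apply_eq_sum]
  calc |∑ c, G y a c * v y c| ≤ ∑ c, |G y a c * v y c| := Finset.abs_sum_le_sum_abs _ _
    _ ≤ ∑ _c : d, B * ‖v y‖ := Finset.sum_le_sum fun c _ => by
        rw [abs_mul]
        exact mul_le_mul (hB a c) (by rw [← Real.norm_eq_abs]; exact PiLp.norm_apply_le (v y) c)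
          (abs_nonneg _) hB0
    _ = (Fintype.card d : ℝ) * B * ‖v y‖ := by rw [Finset.sum_const, Finset.card_univ, nsmul_eq_mul]; ring

omit [DecidableEq d] in
/-- **FT3**: `J • φ` is Lipschitz in time on `[0,T]`, uniformly in space, if the entries of `J` and
the field `φ` are Lipschitz and bounded there. [cite: DiPernaLions1989Invent, §II.1 (admissible test functions)] -/
theorem exists_lipschitz_distort {T : ℝ}
    (hJL : ∃ K : ℝ, ∀ t ∈ Icc 0 T, ∀ s ∈ Icc 0 T, ∀ y a c, |J t y a c - J s y a c| ≤ K * |t - s|)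
    (hJb : ∃ B : ℝ, ∀ t ∈ Icc 0 T, ∀ y a c, |J t y a c| ≤ B)
    (hφL : ∃ L : ℝ, ∀ t ∈ Icc 0 T, ∀ s ∈ Icc 0 T, ∀ y, ‖φ t y - φ s y‖ ≤ L * |t - s|)
    (hφb : ∃ B' : ℝ, ∀ t ∈ Icc 0 T, ∀ y, ‖φ t y‖ ≤ B') :
    ∃ L' : ℝ, 0 ≤ L' ∧ ∀ t ∈ Icc 0 T, ∀ s ∈ Icc 0 T, ∀ y,
      ‖distort (J t) (φ t) y - distort (J s) (φ s) y‖ ≤ L' * |t - s| := by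
  obtain ⟨K, hK⟩ := hJL
  obtain ⟨B, hB⟩ := hJb
  obtain ⟨L, hL⟩ := hφL
  obtain ⟨B', hB'⟩ := hφb
  refine ⟨Real.sqrt (Fintype.card d) * ((Fintype.card d : ℝ) * (|K| * |B'| + |B| * |L|)), by positivity,
    fun t ht s hs y => ?_⟩
  rw [mul_assoc]
  refine norm_le_sqrt_card_mul (by positivity) fun a => ?_
  rw [PiLp.sub_apply, distort_apply_eq_sum, distort_apply_eq_sum, ← Finset.sum_sub_distrib]
  have hts : 0 ≤ |t - s| := abs_nonneg _
  calc |∑ c, (J t y a c * φ t y c - J s y a c * φ s y c)|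
      ≤ ∑ c, |J t y a c * φ t y c - J s y a c * φ s y c| := Finset.abs_sum_le_sum_abs _ _
    _ ≤ ∑ _c : d, (|K| * |B'| + |B| * |L|) * |t - s| := Finset.sum_le_sum fun c _ => by
        have e : J t y a c * φ t y c - J s y a c * φ s y c =
            (J t y a c - J s y a c) * φ t y c + J s y a c * (φ t y c - φ s y c) := by ring
        rw [e]
        have h1 : |φ t y c| ≤ |B'| := by
          calc |φ t y c| = ‖φ t y c‖ := (Real.norm_eq_abs _).symm
            _ ≤ ‖φ t y‖ := PiLp.norm_apply_le (φ t y) c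
            _ ≤ B' := hB' t ht y
            _ ≤ |B'| := le_abs_self _
        have h2 : |φ t y c - φ s y c| ≤ |L| * |t - s| := by
          calc |φ t y c - φ s y c| = ‖(φ t y - φ s y) c‖ := by rw [PiLp.sub_apply, Real.norm_eq_abs]
            _ ≤ ‖φ t y - φ s y‖ := PiLp.norm_apply_le _ c
            _ ≤ L * |t - s| := hL t ht s hs y
            _ ≤ |L| * |t - s| := mul_le_mul_of_nonneg_right (le_abs_self _) hts
        have h3 : |J t y a c - J s y a c| ≤ |K| * |t - s| :=
          (hK t ht s hs y a c).trans (mul_le_mul_of_nonneg_right (le_abs_self _) hts)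
        have h4 : |J s y a c| ≤ |B| := (hB s hs y a c).trans (le_abs_self _)
        calc |(J t y a c - J s y a c) * φ t y c + J s y a c * (φ t y c - φ s y c)|
            ≤ |(J t y a c - J s y a c) * φ t y c| + |J s y a c * (φ t y c - φ s y c)| := abs_add_le _ _
          _ = |J t y a c - J s y a c| * |φ t y c| + |J s y a c| * |φ t y c - φ s y c| := by
              rw [abs_mul, abs_mul]
          _ ≤ |K| * |t - s| * |B'| + |B| * (|L| * |t - s|) := by
              gcongr
          _ = (|K| * |B'| + |B| * |L|) * |t - s| := by ring
    _ = (Fintype.card d : ℝ) * (|K| * |B'| + |B| * |L|) * |t - s| := by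
        rw [Finset.sum_const, Finset.card_univ, nsmul_eq_mul]; ring

/-! ## §3 Clamping a window field in time -/

omit [Fintype d] [DecidableEq d] in
/-- **Clamp corollary**: a field whose space–time lift is continuous on `[a,b] × ℝ^d` gives, after
clamping time to `[a,b]`, a field jointly continuous on ALL of `ℝ × T^d`. [cite: DiPernaLions1989Invent, §II.1 (time cut-off of test functions)] -/
theorem continuous_uncurry_clamp_of_continuousOn_stLift {F : Type*} [TopologicalSpace F]
    {ψ : ℝ → UnitAddTorus d → F} {a b : ℝ} (hab : a ≤ b) (hc : ContinuousOn (stLift ψ) (Icc a b ×ˢ univ)) :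
    Continuous (uncurry fun t y => ψ (max a (min t b)) y) := by
  have hcl : Continuous fun t : ℝ => max a (min t b) := continuous_const.max (continuous_id.min continuous_const)
  have hmem : ∀ t : ℝ, max a (min t b) ∈ Icc a b := fun t => ⟨le_max_left _ _, max_le hab (min_le_right _ _)⟩
  have h : Continuous (stLift fun t y => ψ (max a (min t b)) y) := by
    have e : stLift (fun t y => ψ (max a (min t b)) y) = stLift ψ ∘ fun p : ℝ × EuclideanSpace ℝ d => (max a (min p.1 b), p.2) := by
      funext p; rfl
    rw [e]
    exact hc.comp_continuous ((hcl.comp continuous_fst).prodMk continuous_snd) fun p => mk_mem_prod (hmem p.1) (mem_univ _)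
  exact continuous_uncurry_of_continuous_stLift h

omit [Fintype d] in
/-- **Clamp corollary for the space derivatives**: if the space–time lift of every `∂^l ψ` is continuous
on `[a,b] × ℝ^d` (the conclusion shape of `TorusFlowFrameRegularity`), the clamped field
`t ↦ ψ (max a (min t b))` has ALL iterated space derivatives jointly continuous on `ℝ × T^d`
(the hypothesis shape of the distorted weak class tests). [cite: DiPernaLions1989Invent, §II.1 (time cut-off of test functions)] -/
theorem continuous_uncurry_iterPartialDeriv_clamp {F : Type*} [NormedAddCommGroup F] [NormedSpace ℝ F]
    {ψ : ℝ → UnitAddTorus d → F} {a b : ℝ} (hab : a ≤ b)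
    (hc : ∀ l : List d, ContinuousOn (stLift fun t => iterPartialDeriv l (ψ t)) (Icc a b ×ˢ univ)) (l : List d) :
    Continuous (uncurry fun t y => iterPartialDeriv l (ψ (max a (min t b))) y) :=
  continuous_uncurry_clamp_of_continuousOn_stLift (ψ := fun t y => iterPartialDeriv l (ψ t) y) hab (hc l)

omit [DecidableEq d] in
/-- Clamping is `1`-Lipschitz: `|clamp t − clamp s| ≤ |t − s|`, so time-Lipschitz bounds on `[a,b]`
transfer to the clamped field on all of `ℝ`. [cite: DiPernaLions1989Invent, §II.1 (time cut-off of test functions)] -/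
theorem abs_clamp_sub_clamp_le (a b t s : ℝ) : |max a (min t b) - max a (min s b)| ≤ |t - s| := by
  have h1 : |min t b - min s b| ≤ |t - s| := abs_min_sub_min_le_max _ _ _ _ |>.trans (by
    rw [sub_self, abs_zero, max_eq_left (abs_nonneg _)])
  exact (abs_max_sub_max_le_max _ _ _ _).trans (by
    rw [sub_self, abs_zero, max_eq_right (abs_nonneg _)]; exact h1)

end Torus

end Literature.Analysis.FluidPDE

end
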